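import Mathlib.Data.Matrix.Basic
import Mathlib.Data.Matrix.Reflection
import Mathlib.Tactic
import Summits.Ventures.HSemireg.SchoenCycleCupCertificate
import HarnessLib

/-!
# Venture HSemireg — STEP-0 class (A): the cup-product matrix DERIVED in the kernel from Schoen's class `[Z] = ½(θ₁+θ₂−ω_σ)² + θ₁θ₂`

HONEST FRAMING. Companion of `SchoenCycleCupCertificate.lean` (seat s0-1 of the computation cell `pub-hsemireg`). That file
records the `16 × 16` integer matrix `SchoenCycle.cupMatrix` of `ξ ↦ ξ ∪ [Z]` as DATA (engine output) and kernel-checks its rank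
`12` and nullity `4`. THIS file removes the engine from the trust base of the matrix itself: it implements a small COMPUTABLE
integer model of the exterior algebra `Λ^•ℤ⁸` on the eight generators `0..7 = a₁, a₂, b₁, b₂, a₁′, a₂′, b₁′, b₂′` of
`H¹(J × J)` — a form is its coefficient function on monomials `e_S = e_{i₁} ∧ … ∧ e_{i_k}` (`i₁ < … < i_k`), a monomial being
encoded by the bitmask `Σ_{i ∈ S} 2^i < 256`; the wedge product is the merge-sign formula `(f ∧ g)(S) = Σ_{T ⊆ S} ε(T, S∖T) f(T) g(S∖T)`;
the derivation `D_{p↦q}` extending an elementary `ξ = (e_p ↦ e_q)` replaces `p` by `q` in a monomial and re-sorts — and then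
writes Schoen's class from its three named ingredients, `2[Z] = (θ₁ + θ₂ − ω_σ) ∧ (θ₁ + θ₂ − ω_σ) + 2·θ₁ ∧ θ₂`, and PROVES BY
KERNEL EVALUATION (`decide +kernel`) that for all `256` pairs (row `r`, column `c`) the coefficient of `D_{ξ_c}(2[Z])` on the
`r`-th type-`(1,3)` monomial is `2 · cupMatrix r c`, that it vanishes off those sixteen monomials, and that `2[Z]` is of type
`(2,2)` with `(2[Z])² = 32·vol` (`Z·Z = 8`, as in RESULT-A). What remains OUTSIDE the kernel is only the dictionary:
(i) `Λ^•ℤ⁸ ⊗ ℂ` with `a = H^{1,0}`, `b = H^{0,1}` is `H^•(J × J, ℂ)` with its Hodge splitting and cup product (Künneth,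
`H^•(J) = Λ^•H¹(J)`); (ii) `[Δ_J] = ½(θ₁ + θ₂ − ω_σ)²` and `[C × C] = θ₁θ₂` (Poincaré `[C] = θ`, `[pt] = θ²/2`; Schoen 1998 §10 /
RESULT-A §3); (iii) `ξ ∈ H¹(X, T_X) = Hom(H^{1,0}, H^{0,1})` acts on `H^{p,q}` by the derivation rule (Bloch (2.5)). Nothing here
is a statement about a variety beyond that dictionary; nothing here says that HC / HC_CM / HC_AV holds.
References: [Bloch1972Semiregularity] (2.5), Prop. (6.8); [Schoen1998HodgeWeilAddendum] §10.
-/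

namespace Summit.Ventures.HSemireg.SchoenCycle

/-! ## A computable integer exterior algebra on eight generators (bitmask monomials) -/

/-- `bit i m`: generator `i` occurs in the monomial with bitmask `m`. [folklore] -/
def bit (i m : ℕ) : Bool := (m >>> i) % 2 == 1

/-- the increasing list of generators occurring in the monomial `m`. [folklore] -/
def gens (m : ℕ) : List ℕ := (List.range 8).filter (fun i => bit i m)

/-- all sub-monomials (submasks) of `m`. [folklore] -/
def submasks (m : ℕ) : List ℕ :=
  (List.range 8).foldr (fun i acc => if bit i m then acc ++ acc.map (· + 2 ^ i) else acc) [0]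

/-- number of inversions when the increasing word of `t` is followed by the increasing word of `u`. [folklore] -/
def inv (t u : ℕ) : ℕ := ((gens t).map (fun a => ((gens u).filter (fun b => decide (b < a))).length)).sum

/-- the merge sign `ε(t,u) = (−1)^{inv t u}`: `e_t ∧ e_u = ε(t,u) e_{t ∪ u}` for disjoint `t`, `u`. [folklore] -/
def eps (t u : ℕ) : ℤ := if inv t u % 2 = 0 then 1 else -1

/-- integer forms: coefficient functions on monomials (bitmasks `< 256`). [folklore] -/
abbrev Form : Type := ℕ → ℤ

/-- wedge product: `(f ∧ g)(S) = Σ_{T ⊆ S} ε(T, S∖T) f(T) g(S∖T)` (`S∖T` = `S xor T` for `T ⊆ S`). [folklore] -/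
def wedge (f g : Form) : Form := fun m => ((submasks m).map (fun t => eps t (m ^^^ t) * f t * g (m ^^^ t))).sum

/-- the generator `e_i` as a form. [folklore] -/
def gen (i : ℕ) : Form := fun m => if m = 2 ^ i then 1 else 0

/-- pointwise sum of forms. [folklore] -/
def fadd (f g : Form) : Form := fun m => f m + g m
/-- pointwise difference of forms. [folklore] -/
def fsub (f g : Form) : Form := fun m => f m - g m
/-- integer multiple of a form. [folklore] -/
def fsmul (n : ℤ) (f : Form) : Form := fun m => n * f m

/-- the derivation `D_{p↦q}` of `Λ^•` extending the elementary map `e_p ↦ e_q` (other generators to `0`), on coefficient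
functions: the coefficient of `D(f)` on a monomial `S ∋ q`, `S ∌ p` is `(−1)^{#\{x ∈ S : x strictly between p and q\}}·f(S − q + p)`
(replace and re-sort). This is how `ξ = (p ↦ q) ∈ Hom(H^{1,0},H^{0,1}) = H¹(X,T_X)` acts on `Λ^•H¹ = H^•(X)` to first order.
[cite: Bloch1972Semiregularity, (2.5)] -/
def der (p q : ℕ) (f : Form) : Form := fun m =>
  if (bit q m && !bit p m) = true then
    (if ((gens m).filter (fun x => decide (min p q < x ∧ x < max p q))).length % 2 = 0 then 1 else -1)
      * f ((m ^^^ 2 ^ q) ||| 2 ^ p)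
  else 0

/-! ## Schoen's class from its ingredients -/

/-- `θ₁ = a₁∧b₁ + a₂∧b₂ = e₀∧e₂ + e₁∧e₃`: the principal polarisation of the first factor. [folklore] -/
def theta1 : Form := fadd (wedge (gen 0) (gen 2)) (wedge (gen 1) (gen 3))
/-- `θ₂ = a₁′∧b₁′ + a₂′∧b₂′ = e₄∧e₆ + e₅∧e₇`. [folklore] -/
def theta2 : Form := fadd (wedge (gen 4) (gen 6)) (wedge (gen 5) (gen 7))
/-- `ω_σ = Σ_i (a_i∧b_i′ + a_i′∧b_i) = e₀∧e₆ + e₄∧e₂ + e₁∧e₇ + e₅∧e₃`, the mixed class with `[Δ_J] = ½(θ₁ + θ₂ − ω_σ)²`.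
[cite: Schoen1998HodgeWeilAddendum, §10] -/
def omegaSigma : Form :=
  fadd (fadd (wedge (gen 0) (gen 6)) (wedge (gen 4) (gen 2))) (fadd (wedge (gen 1) (gen 7)) (wedge (gen 5) (gen 3)))
/-- `y = θ₁ + θ₂ − ω_σ` as built from the generators. [folklore] -/
def ySlow : Form := fsub (fadd theta1 theta2) omegaSigma
/-- `y = θ₁ + θ₂ − ω_σ` as an explicit coefficient table on the eight 2-monomials it involves (`yFast_eq` checks it against
`ySlow` on all `256` monomials): masks `5 = e₀e₂, 10 = e₁e₃, 80 = e₄e₆, 160 = e₅e₇ ↦ 1`; `65 = e₀e₆ ↦ −1, 20 = e₂e₄ ↦ +1,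
130 = e₁e₇ ↦ −1, 40 = e₃e₅ ↦ +1` (note `e₄∧e₂ = −e₂e₄`, `e₅∧e₃ = −e₃e₅`). [folklore] -/
def yFast : Form := fun m =>
  if m = 5 then 1 else if m = 10 then 1 else if m = 80 then 1 else if m = 160 then 1 else
  if m = 65 then -1 else if m = 20 then 1 else if m = 130 then -1 else if m = 40 then 1 else 0
/-- `θ₁` as an explicit table (`5, 10 ↦ 1`). [folklore] -/
def theta1Fast : Form := fun m => if m = 5 then 1 else if m = 10 then 1 else 0
/-- `θ₂` as an explicit table (`80, 160 ↦ 1`). [folklore] -/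
def theta2Fast : Form := fun m => if m = 80 then 1 else if m = 160 then 1 else 0
/-- `2[Z] = (θ₁ + θ₂ − ω_σ)∧(θ₁ + θ₂ − ω_σ) + 2·θ₁∧θ₂` — twice the class of Schoen's `Z = Δ_J ∪ (C × C)` (kept integral),
computed from the tables. [cite: Schoen1998HodgeWeilAddendum, §10] -/
def twoZ : Form := fadd (wedge yFast yFast) (fsmul 2 (wedge theta1Fast theta2Fast))

/-- the tables ARE the classes built from the generators: `yFast = θ₁ + θ₂ − ω_σ`, `theta1Fast = θ₁`, `theta2Fast = θ₂` on every
monomial. [folklore] -/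
theorem fast_eq : ∀ m < 256, yFast m = ySlow m ∧ theta1Fast m = theta1 m ∧ theta2Fast m = theta2 m := by
  decide +kernel

/-! ## Bases of record and the derivation theorem -/

/-- source generator `p` of the `c`-th column `ξ_{p↦q}` (column order of `SchoenCycle.cupMatrix`). [folklore] -/
def xiSrc : Fin 16 → ℕ := ![0, 0, 0, 0, 1, 1, 1, 1, 4, 4, 4, 4, 5, 5, 5, 5]
/-- target generator `q` of the `c`-th column `ξ_{p↦q}`. [folklore] -/
def xiTgt : Fin 16 → ℕ := ![2, 3, 6, 7, 2, 3, 6, 7, 2, 3, 6, 7, 2, 3, 6, 7]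
/-- bitmask of the `r`-th row monomial (row order of `SchoenCycle.cupMatrix`): the sixteen type-`(1,3)` monomials
{0,2,3,6}, {0,2,3,7}, {0,2,6,7}, {0,3,6,7}, {1,2,3,6}, {1,2,3,7}, {1,2,6,7}, {1,3,6,7}, {2,3,4,6}, {2,3,4,7}, {2,3,5,6}, {2,3,5,7}, {2,4,6,7}, {2,5,6,7}, {3,4,6,7}, {3,5,6,7}. [folklore] -/
def rowMask : Fin 16 → ℕ := ![77, 141, 197, 201, 78, 142, 198, 202, 92, 156, 108, 172, 212, 228, 216, 232]

/-- the sixteen row masks are exactly the `4`-monomials with one holomorphic generator (`0, 1, 4, 5`) and three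
antiholomorphic ones — i.e. ALL of type `(1,3)`. [folklore] -/
theorem rowMask_spec : ∀ m < 256,
    ((∃ r : Fin 16, rowMask r = m) ↔
      ((gens m).length = 4 ∧ ((gens m).filter (fun x => decide (x = 0 ∨ x = 1 ∨ x = 4 ∨ x = 5))).length = 1)) := by
  decide +kernel

/-- `2[Z]` has pure degree `4` and Hodge type `(2,2)`: it vanishes on every monomial that is not a `4`-monomial with exactly two
holomorphic generators. [folklore] -/
theorem twoZ_type : ∀ m < 256,
    ¬ ((gens m).length = 4 ∧ ((gens m).filter (fun x => decide (x = 0 ∨ x = 1 ∨ x = 4 ∨ x = 5))).length = 2) → twoZ m = 0 := by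
  decide +kernel

/-- `(2[Z]) ∧ (2[Z]) = 32 · (½θ₁²) ∧ (½θ₂²)` on the top monomial, i.e. `Z·Z = 8` with the orientation `vol = ½θ₁² ∧ ½θ₂²`
(RESULT-A: `Z² = K_S² − c₂ = 8` for a Schoen surface). [folklore] -/
theorem twoZ_sq_top : wedge twoZ twoZ 255 * 4 = 32 * wedge (wedge theta1Fast theta1Fast) (wedge theta2Fast theta2Fast) 255 := by
  decide +kernel

/-- **The derivation theorem.** For every column `c < 16` (elementary `ξ_c = (xiSrc c ↦ xiTgt c)`) and row `r`
(monomial `rowMask r`): the coefficient of `D_{ξ_c}(2[Z])` on that monomial is `2 · cupMatrix r c`. So `SchoenCycle.cupMatrix`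
IS the matrix of `ξ ↦ ξ ∪ [Z]` in the stated bases, by kernel evaluation. [cite: Bloch1972Semiregularity, (2.5) and Prop. (6.8)] -/
theorem der_twoZ_eq_cupMatrix : ∀ r c : Fin 16, der (xiSrc c) (xiTgt c) twoZ (rowMask r) = 2 * cupMatrix r c := by
  decide +kernel

/-- completeness of the rows: `D_{ξ_c}(2[Z])` vanishes on every `4`-monomial outside the sixteen rows (no part of `ξ ∪ [Z]` is
lost by reading the type-`(1,3)` rows only; on monomials of degree `≠ 4` it vanishes because `D` preserves degree and `2[Z]` has
degree `4`, `twoZ_type`). [folklore] -/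
theorem der_twoZ_off_rows : ∀ c : Fin 16, ∀ m < 256, (gens m).length = 4 → (∀ r : Fin 16, rowMask r ≠ m) →
    der (xiSrc c) (xiTgt c) twoZ m = 0 := by
  decide +kernel

end Summit.Ventures.HSemireg.SchoenCycle
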